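import Mathlib
import HarnessLib
import Summits.NavierStokesRegularity.NavierStokesRegularity.Theorems.UnthreadedDoorCellFluxDefs
import Summits.NavierStokesRegularity.NavierStokesRegularity.Theorems.UnthreadedDoorNetFluxNearCentreFlux

/-!
# Route `UnthreadedDoor`, crux `PoloidalLiouville` (stmt-NavierStokesRegularity-1222), WALL W1 — crux idea «cell-flux», support toward
# Σ-0bR₂ `ClusterFluxNearCentreLipschitz`: QUADRATIC CONTROL AT SPHERE-CRITICAL POINTS (the event step of the envelope principle)

For a toroidal representation `curl v = ∇T × (x − x₀)` (`v ∈ C²`, `T ∈ C¹` off `x₀`) with `‖D curl v‖ ≤ L` on `B̄(x₀,1)`, a radius `0 < r ≤ 1`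
and a SPHERE-CRITICAL point `p ∈ S_r(x₀)` (`∇T(p) × (p − x₀) = 0`, i.e. `curl v (p) = 0`): along the great circle `γ` from `p` to `q ∈ S_r(x₀)`
one has `(T∘γ)′(θ) = −⟪n, curl v (γ θ)⟫` (NF-0's identity) and `curl v (γ θ) = curl v (γ θ) − curl v (p)` has norm `≤ L r θ`, whence

  `|T q − T p| ≤ L r · θ(p,q)² ≤ (π² L / (4 r)) · ‖q − p‖²`   (`abs_sub_le_of_mem_sphCrit`).

So near a sphere-critical point the slice is FLAT TO SECOND ORDER with constant `O(L r)` in the angle — the quantitative reason why, in Σ-0bR₂,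
moving a class boundary (which consists of sphere-critical points, `…CellFluxClassOscCritical`, p733539) or giving birth to a class near a critical
point costs only `O(L ρ² / r)` in oscillation:

* `two_mul_sq_div_pi_sq_le_one_sub_cos` — Jordan: `2θ²/π² ≤ 1 − cos θ` on `[0, π]`;
* `abs_sub_le_of_mem_sphCrit` — the quadratic bound above;
* `setOsc_le_of_subset_closedBall_sphCrit` — a nonempty `C ⊆ S_r(x₀) ∩ B̄(p, ρ)` with `p` sphere-critical has `osc_C T ≤ π² L ρ² / (2 r)`
  (newborn classes are small);
* `sSup_le_sSup_add_of_near_sphCrit` / `sInf_sub_le_sInf_of_near_sphCrit` / ★ `abs_setOsc_sub_setOsc_le_of_near_sphCrit` — the EVENT STEP: if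
  every point of `U'` lies in `U` or within `ρ` of a sphere-critical point of `closure U`, and vice versa, then
  `|osc_{U'} T − osc_U T| ≤ π² L ρ² / (2 r)`.

With `…ClassOscTransport` (rigid transport, πL|ρ − ρ'| resp. πMa|t − t'|) and `…LipschitzSelection` (finitely many re-groupings) this is the
quantitative envelope principle behind Σ-0bR₂; what remains OPEN is the geometric input that an admissible rule's classes at nearby parameters
differ only within `ρ = O(|Δ|^{1/2})` of critical points, with finitely many re-groupings (analytic category).

HONEST LABEL: support lemmas strictly below W1; Σ-0bR₂, the cell-flux chain, `PoloidalLiouville` ⟨1222⟩, W1 and NS regularity are OPEN — NOT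
proved.  `--supports stmt-NavierStokesRegularity-1222 --as helper`.  [folklore]
-/

noncomputable section

-- the summit and its single sub-problem share the name (CONVENTIONS §1)
set_option linter.dupNamespace false

open Set Function Filter Topology InnerProductSpace MeasureTheory
open scoped RealInnerProductSpace ContDiff

namespace Summit.NavierStokesRegularity.NavierStokesRegularity.Theorems.PoloidalLiouville.CellFlux

open Summit.NavierStokesRegularity.NavierStokesRegularity.Theorems.PoloidalLiouville.NetFlux
  (E3 ne_center_of_mem_sphere continuousOn_sphere_of_continuousOn_compl bddAbove_image_sphere exists_greatCircle
   cross_add_smul_right cross_cross_eq_neg_of_unit_orth norm_cross_of_unit_orth inner_cross_right_eq_neg_inner_cross)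
open Literature.Analysis Literature.Analysis.FluidPDE

/-! ### Jordan's inequality in the form `2θ²/π² ≤ 1 − cos θ` -/

/-- **Jordan**: `2 θ² / π² ≤ 1 − cos θ` for `θ ∈ [0, π]` (`1 − cos θ = 2 sin²(θ/2)` and `sin(θ/2) ≥ θ/π`). [folklore] -/
theorem two_mul_sq_div_pi_sq_le_one_sub_cos {θ : ℝ} (h0 : 0 ≤ θ) (hπ : θ ≤ Real.pi) :
    2 * θ ^ 2 / Real.pi ^ 2 ≤ 1 - Real.cos θ := by
  have hpi : 0 < Real.pi := Real.pi_pos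
  have hs : 2 / Real.pi * (θ / 2) ≤ Real.sin (θ / 2) :=
    Real.mul_le_sin (by linarith) (by linarith)
  have hs0 : 0 ≤ 2 / Real.pi * (θ / 2) := by positivity
  have hcos : 1 - Real.cos θ = 2 * Real.sin (θ / 2) ^ 2 := by
    have h := Real.cos_sq (θ / 2)
    rw [show 2 * (θ / 2) = θ by ring] at h
    have h2 := Real.sin_sq_add_cos_sq (θ / 2)
    linarith
  rw [hcos]
  have h3 : (2 / Real.pi * (θ / 2)) ^ 2 ≤ Real.sin (θ / 2) ^ 2 := pow_le_pow_left₀ hs0 hs 2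
  have h4 : 2 / Real.pi * (θ / 2) = θ / Real.pi := by
    rw [div_mul_div_comm, mul_comm 2 θ, mul_div_mul_right _ _ (two_ne_zero)]
  rw [h4, div_pow] at h3
  have h5 : 2 * θ ^ 2 / Real.pi ^ 2 = 2 * (θ ^ 2 / Real.pi ^ 2) := by ring
  linarith [h5]

/-! ### The quadratic bound at a sphere-critical point -/

/-- **Quadratic control at a sphere-critical point.**  For `v ∈ C²`, `T ∈ C¹` off `x₀`, `curl v = ∇T × (x − x₀)`, `‖D curl v‖ ≤ L` on `B̄(x₀,1)`,
`0 < r ≤ 1`, `p ∈ sphCrit T x₀ r` and `q ∈ S_r(x₀)`: `|T q − T p| ≤ (π² L / (4 r)) ‖q − p‖²`.  Along the great circle `γ` from `p` to `q`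
(angle `θ₀ ∈ [0, π]`): `(T∘γ)′(θ) = −⟪n, curl v (γ θ)⟫` with `curl v (p) = 0`, so `|(T∘γ)′(θ)| ≤ L ‖γ θ − p‖ ≤ L r θ ≤ L r θ₀` on `[0, θ₀]`,
and `|T q − T p| ≤ L r θ₀² ≤ L r (π²/4) ‖q − p‖²/r²` by Jordan (`‖q − p‖² = 2 r² (1 − cos θ₀)`; the sharp constant has `/8`). [folklore] -/
theorem abs_sub_le_of_mem_sphCrit {v : E3 → E3} {T : E3 → ℝ} {x₀ p q : E3} {L r : ℝ} (hv : ContDiff ℝ 2 v)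
    (hT : ContDiffOn ℝ 1 T ({x₀}ᶜ)) (hrep : ∀ x, curl v x = cross (gradient T x) (x - x₀))
    (hL : ∀ x ∈ Metric.closedBall x₀ 1, ‖fderiv ℝ (curl v) x‖ ≤ L) (hr : 0 < r) (hr1 : r ≤ 1)
    (hp : p ∈ sphCrit T x₀ r) (hq : q ∈ Metric.sphere x₀ r) :
    |T q - T p| ≤ Real.pi ^ 2 * L / (4 * r) * ‖q - p‖ ^ 2 := by
  have hpS : p ∈ Metric.sphere x₀ r := hp.1
  have hpn : ‖p - x₀‖ = r := mem_sphere_iff_norm.1 hpS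
  have hqn : ‖q - x₀‖ = r := mem_sphere_iff_norm.1 hq
  have hω : ContDiff ℝ 1 (curl v) := contDiff_curl (n := 1) (by exact_mod_cast hv)
  have hL0 : 0 ≤ L := (norm_nonneg _).trans (hL x₀ (Metric.mem_closedBall_self zero_le_one))
  have hωp : curl v p = 0 := by rw [hrep]; exact hp.2
  obtain ⟨n, θ₀, hn1, hna, hθ₀, hb⟩ := exists_greatCircle (a := p - x₀) (b := q - x₀) hr hpn hqn
  -- the great circle (as in NF-0's arc bound)
  set γ : ℝ → E3 := fun θ => x₀ + (Real.cos θ • (p - x₀) + Real.sin θ • cross n (p - x₀)) with hγ_def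
  have hγ0 : γ 0 = p := by simp [hγ_def]
  have hγ1 : γ θ₀ = q := by rw [hγ_def]; simp only; rw [← hb]; abel
  have hac : ⟪p - x₀, cross n (p - x₀)⟫ = 0 := by
    simp only [Tao2016.real_inner_fin3, cross_apply_zero, cross_apply_one, cross_apply_two]; ring
  have hnw : ⟪n, cross n (p - x₀)⟫ = 0 := by
    have h := inner_cross_right_eq_neg_inner_cross n n (p - x₀)
    linarith
  have hnγ : ∀ θ, ⟪n, γ θ - x₀⟫ = 0 := by
    intro θ
    rw [hγ_def]
    simp only [add_sub_cancel_left, inner_add_right, real_inner_smul_right, hna, hnw, mul_zero, add_zero]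
  have hγr : ∀ θ, ‖γ θ - x₀‖ = r := by
    intro θ
    have hsq : ‖γ θ - x₀‖ ^ 2 = r ^ 2 := by
      rw [hγ_def]
      simp only [add_sub_cancel_left]
      rw [← real_inner_self_eq_norm_sq, inner_add_left, inner_add_right, inner_add_right, real_inner_smul_left,
        real_inner_smul_left, real_inner_smul_left, real_inner_smul_left, real_inner_smul_right,
        real_inner_smul_right, real_inner_smul_right, real_inner_smul_right, real_inner_self_eq_norm_sq,
        real_inner_self_eq_norm_sq, norm_cross_of_unit_orth hn1 hna, hpn, hac,
        real_inner_comm (p - x₀) (cross n (p - x₀)), hac]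
      linear_combination r ^ 2 * Real.cos_sq_add_sin_sq θ
    have h := Real.sqrt_sq (norm_nonneg (γ θ - x₀))
    rw [hsq, Real.sqrt_sq hr.le] at h
    exact h.symm
  have hγne : ∀ θ, γ θ ≠ x₀ := fun θ h => by
    have := hγr θ
    rw [h, sub_self, norm_zero] at this
    exact hr.ne' this.symm
  have hγball : ∀ θ, γ θ ∈ Metric.closedBall x₀ 1 := fun θ => by
    rw [Metric.mem_closedBall, dist_eq_norm, hγr θ]; exact hr1
  -- `γ' = n × (γ − x₀)`, of norm `r`
  have hγd : ∀ θ, HasDerivAt γ (cross n (γ θ - x₀)) θ := by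
    intro θ
    have h := (((Real.hasDerivAt_cos θ).smul_const (p - x₀)).add
      ((Real.hasDerivAt_sin θ).smul_const (cross n (p - x₀)))).const_add x₀
    have e : cross n (γ θ - x₀) = -Real.sin θ • (p - x₀) + Real.cos θ • cross n (p - x₀) := by
      rw [hγ_def]
      simp only [add_sub_cancel_left]
      rw [cross_add_smul_right, cross_cross_eq_neg_of_unit_orth hn1 hna, smul_neg, ← neg_smul]
      abel
    rw [e]
    exact h
  have hγ'n : ∀ θ, ‖cross n (γ θ - x₀)‖ = r := fun θ => by rw [norm_cross_of_unit_orth hn1 (hnγ θ), hγr θ]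
  -- chord ≤ arc: `‖γ θ − p‖ ≤ r |θ|`
  have hchord : ∀ θ, ‖γ θ - p‖ ≤ r * |θ| := by
    intro θ
    have h := Convex.norm_image_sub_le_of_norm_hasDerivWithin_le (s := univ) (f := γ) (C := r)
      (fun s _ => (hγd s).hasDerivWithinAt) (fun s _ => (hγ'n s).le) convex_univ (mem_univ 0) (mem_univ θ)
    rw [hγ0, sub_zero, Real.norm_eq_abs] at h
    exact h
  -- derivative of `T ∘ γ`: `(T∘γ)'(θ) = −⟪n, curl v (γ θ)⟫`, of size `≤ L r |θ|`
  set h' : ℝ → ℝ := fun θ => fderiv ℝ T (γ θ) (cross n (γ θ - x₀)) with hh'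
  have hTd : ∀ θ, HasDerivAt (fun θ => T (γ θ)) (h' θ) θ := by
    intro θ
    have hd : DifferentiableAt ℝ T (γ θ) :=
      (hT.differentiableOn one_ne_zero _ (hγne θ)).differentiableAt (isOpen_compl_singleton.mem_nhds (hγne θ))
    exact hd.hasFDerivAt.comp_hasDerivAt θ (hγd θ)
  have hh'eq : ∀ θ, h' θ = -⟪n, curl v (γ θ)⟫ := by
    intro θ
    simp only [hh']
    rw [← LocalHelmholtz.inner_gradient_left_eq_fderiv, inner_cross_right_eq_neg_inner_cross, hrep]
  have hbound : ∀ θ, |h' θ| ≤ L * r * |θ| := by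
    intro θ
    rw [hh'eq, abs_neg]
    have h1 : |⟪n, curl v (γ θ)⟫| ≤ ‖curl v (γ θ)‖ := by
      calc |⟪n, curl v (γ θ)⟫| ≤ ‖n‖ * ‖curl v (γ θ)‖ := abs_real_inner_le_norm _ _
        _ = ‖curl v (γ θ)‖ := by rw [hn1, one_mul]
    have h2 : ‖curl v (γ θ) - curl v p‖ ≤ L * ‖γ θ - p‖ :=
      (convex_closedBall x₀ 1).norm_image_sub_le_of_norm_fderiv_le
        (fun y _ => (hω.differentiable one_ne_zero) y) hL
        (by rw [Metric.mem_closedBall, dist_eq_norm, hpn]; exact hr1) (hγball θ)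
    rw [hωp, sub_zero] at h2
    calc |⟪n, curl v (γ θ)⟫| ≤ ‖curl v (γ θ)‖ := h1
      _ ≤ L * ‖γ θ - p‖ := h2
      _ ≤ L * (r * |θ|) := mul_le_mul_of_nonneg_left (hchord θ) hL0
      _ = L * r * |θ| := by ring
  -- mean value inequality on `[0, θ₀]` with the bound `L r θ₀` for the derivative
  have hmv := Convex.norm_image_sub_le_of_norm_hasDerivWithin_le (s := Icc 0 θ₀) (f := fun θ => T (γ θ))
    (C := L * r * θ₀) (fun θ _ => (hTd θ).hasDerivWithinAt)
    (fun θ hθ => by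
      rw [Real.norm_eq_abs]
      have h1 := hbound θ
      rw [abs_of_nonneg hθ.1] at h1
      exact h1.trans (mul_le_mul_of_nonneg_left hθ.2 (by positivity)))
    (convex_Icc 0 θ₀) (left_mem_Icc.2 hθ₀.1) (right_mem_Icc.2 hθ₀.1)
  rw [hγ0, hγ1, sub_zero, Real.norm_eq_abs, Real.norm_eq_abs, abs_of_nonneg hθ₀.1] at hmv
  have hang : |T q - T p| ≤ L * r * θ₀ ^ 2 := by
    calc |T q - T p| ≤ L * r * θ₀ * θ₀ := hmv
      _ = L * r * θ₀ ^ 2 := by ring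
  -- chord versus angle: `‖q − p‖² = 2 r² (1 − cos θ₀) ≥ 4 r² θ₀² / π²`
  have hchord2 : ‖q - p‖ ^ 2 = 2 * r ^ 2 * (1 - Real.cos θ₀) := by
    have e : q - p = (Real.cos θ₀ - 1) • (p - x₀) + Real.sin θ₀ • cross n (p - x₀) := by
      have e1 : q - p = (q - x₀) - (p - x₀) := by abel
      rw [e1, hb, sub_smul, one_smul]
      abel
    rw [e, ← real_inner_self_eq_norm_sq, inner_add_left, inner_add_right, inner_add_right, real_inner_smul_left,
      real_inner_smul_left, real_inner_smul_left, real_inner_smul_left, real_inner_smul_right,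
      real_inner_smul_right, real_inner_smul_right, real_inner_smul_right, real_inner_self_eq_norm_sq,
      real_inner_self_eq_norm_sq, norm_cross_of_unit_orth hn1 hna, hpn, hac,
      real_inner_comm (p - x₀) (cross n (p - x₀)), hac]
    linear_combination r ^ 2 * Real.cos_sq_add_sin_sq θ₀
  have hjordan := two_mul_sq_div_pi_sq_le_one_sub_cos hθ₀.1 hθ₀.2
  have hpi : 0 < Real.pi := Real.pi_pos
  have hθsq : θ₀ ^ 2 ≤ Real.pi ^ 2 / (4 * r ^ 2) * ‖q - p‖ ^ 2 := by
    rw [hchord2]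
    have h1 : θ₀ ^ 2 ≤ Real.pi ^ 2 / 2 * (1 - Real.cos θ₀) := by
      have h2 : 2 * θ₀ ^ 2 / Real.pi ^ 2 * (Real.pi ^ 2 / 2) = θ₀ ^ 2 := by field_simp
      have := mul_le_mul_of_nonneg_right hjordan (by positivity : (0 : ℝ) ≤ Real.pi ^ 2 / 2)
      rw [h2] at this
      linarith
    have h3 : Real.pi ^ 2 / (4 * r ^ 2) * (2 * r ^ 2 * (1 - Real.cos θ₀)) = Real.pi ^ 2 / 2 * (1 - Real.cos θ₀) := by
      field_simp
      ring
    rw [h3]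
    exact h1
  calc |T q - T p| ≤ L * r * θ₀ ^ 2 := hang
    _ ≤ L * r * (Real.pi ^ 2 / (4 * r ^ 2) * ‖q - p‖ ^ 2) := mul_le_mul_of_nonneg_left hθsq (by positivity)
    _ = Real.pi ^ 2 * L / (4 * r) * ‖q - p‖ ^ 2 := by
        field_simp

/-! ### Newborn classes are small -/

/-- **A class confined near a sphere-critical point has small oscillation**: if `C ⊆ S_r(x₀) ∩ B̄(p, ρ)` is nonempty and `p` is sphere-critical,
then `osc_C T ≤ π² L ρ² / (2 r)`. [folklore] -/
theorem setOsc_le_of_subset_closedBall_sphCrit {v : E3 → E3} {T : E3 → ℝ} {x₀ p : E3} {L r ρ : ℝ} (hv : ContDiff ℝ 2 v)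
    (hT : ContDiffOn ℝ 1 T ({x₀}ᶜ)) (hrep : ∀ x, curl v x = cross (gradient T x) (x - x₀))
    (hL : ∀ x ∈ Metric.closedBall x₀ 1, ‖fderiv ℝ (curl v) x‖ ≤ L) (hr : 0 < r) (hr1 : r ≤ 1)
    (hp : p ∈ sphCrit T x₀ r) {C : Set E3} (hC : C ⊆ Metric.sphere x₀ r ∩ Metric.closedBall p ρ) (hne : C.Nonempty) :
    setOsc T C ≤ Real.pi ^ 2 * L * ρ ^ 2 / (2 * r) := by
  have hL0 : 0 ≤ L := (norm_nonneg _).trans (hL x₀ (Metric.mem_closedBall_self zero_le_one))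
  set B : ℝ := Real.pi ^ 2 * L / (4 * r) * ρ ^ 2 with hB
  have hB0 : 0 ≤ B := by positivity
  -- every value on `C` is within `B` of `T p`
  have hnear : ∀ q ∈ C, |T q - T p| ≤ B := by
    intro q hq
    have h := abs_sub_le_of_mem_sphCrit hv hT hrep hL hr hr1 hp (hC hq).1
    have hqp : ‖q - p‖ ≤ ρ := by rw [← dist_eq_norm]; exact Metric.mem_closedBall.1 (hC hq).2
    have hqp2 : ‖q - p‖ ^ 2 ≤ ρ ^ 2 := pow_le_pow_left₀ (norm_nonneg _) hqp 2
    exact h.trans (mul_le_mul_of_nonneg_left hqp2 (by positivity))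
  have hneI : (T '' C).Nonempty := hne.image T
  have hsup : sSup (T '' C) ≤ T p + B := csSup_le hneI (by
    rintro _ ⟨q, hq, rfl⟩; linarith [(abs_le.1 (hnear q hq)).2])
  have hinf : T p - B ≤ sInf (T '' C) := le_csInf hneI (by
    rintro _ ⟨q, hq, rfl⟩; linarith [(abs_le.1 (hnear q hq)).1])
  have e : Real.pi ^ 2 * L * ρ ^ 2 / (2 * r) = 2 * B := by rw [hB]; field_simp; ring
  rw [e, setOsc]
  linarith

/-! ### The event step: two sets that differ only near sphere-critical points -/

/-- A value at a point of `closure U` is at most `sSup (T '' U)` (for `T` continuous on the sphere, `U ⊆ S_r(x₀)`). [folklore] -/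
theorem apply_le_csSup_of_mem_closure {T : E3 → ℝ} {x₀ p : E3} {r : ℝ} {U : Set E3} (hT : ContinuousOn T (Metric.sphere x₀ r))
    (hU : U ⊆ Metric.sphere x₀ r) (hp : p ∈ closure U) : T p ≤ sSup (T '' U) := by
  have hclS : closure U ⊆ Metric.sphere x₀ r := closure_minimal hU Metric.isClosed_sphere
  have hbdd : BddAbove (T '' U) := (bddAbove_image_sphere hT).mono (image_mono hU)
  have hfx : T p ∈ closure (T '' U) := (hT.mono hclS).image_closure ⟨p, hp, rfl⟩
  exact (closure_minimal (fun y hy => le_csSup hbdd hy) isClosed_Iic : closure (T '' U) ⊆ Iic (sSup (T '' U))) hfx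

/-- A value at a point of `closure U` is at least `sInf (T '' U)`. [folklore] -/
theorem csInf_le_apply_of_mem_closure {T : E3 → ℝ} {x₀ p : E3} {r : ℝ} {U : Set E3} (hT : ContinuousOn T (Metric.sphere x₀ r))
    (hU : U ⊆ Metric.sphere x₀ r) (hp : p ∈ closure U) : sInf (T '' U) ≤ T p := by
  have hclS : closure U ⊆ Metric.sphere x₀ r := closure_minimal hU Metric.isClosed_sphere
  have hbdd : BddBelow (T '' U) := ((isCompact_sphere x₀ r).bddBelow_image hT).mono (image_mono hU)
  have hfx : T p ∈ closure (T '' U) := (hT.mono hclS).image_closure ⟨p, hp, rfl⟩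
  exact (closure_minimal (fun y hy => csInf_le hbdd hy) isClosed_Ici : closure (T '' U) ⊆ Ici (sInf (T '' U))) hfx

/-- **Event step, upper half**: if every point of `U'` lies in `U` or within `ρ` of a sphere-critical point of `closure U`
(`U, U' ⊆ S_r(x₀)` nonempty), then `sSup (T '' U') ≤ sSup (T '' U) + π² L ρ² / (4 r)`. [folklore] -/
theorem sSup_le_sSup_add_of_near_sphCrit {v : E3 → E3} {T : E3 → ℝ} {x₀ : E3} {L r ρ : ℝ} (hv : ContDiff ℝ 2 v)
    (hT : ContDiffOn ℝ 1 T ({x₀}ᶜ)) (hrep : ∀ x, curl v x = cross (gradient T x) (x - x₀))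
    (hL : ∀ x ∈ Metric.closedBall x₀ 1, ‖fderiv ℝ (curl v) x‖ ≤ L) (hr : 0 < r) (hr1 : r ≤ 1)
    {U U' : Set E3} (hU : U ⊆ Metric.sphere x₀ r) (hU' : U' ⊆ Metric.sphere x₀ r) (hne' : U'.Nonempty)
    (hnear : ∀ q ∈ U', q ∈ U ∨ ∃ p ∈ closure U ∩ sphCrit T x₀ r, ‖q - p‖ ≤ ρ) :
    sSup (T '' U') ≤ sSup (T '' U) + Real.pi ^ 2 * L / (4 * r) * ρ ^ 2 := by
  have hL0 : 0 ≤ L := (norm_nonneg _).trans (hL x₀ (Metric.mem_closedBall_self zero_le_one))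
  have hc := continuousOn_sphere_of_continuousOn_compl hT.continuousOn hr
  have hbdd : BddAbove (T '' U) := (bddAbove_image_sphere hc).mono (image_mono hU)
  refine csSup_le (hne'.image T) ?_
  rintro _ ⟨q, hq, rfl⟩
  have hB0 : 0 ≤ Real.pi ^ 2 * L / (4 * r) * ρ ^ 2 := by positivity
  rcases hnear q hq with hqU | ⟨p, ⟨hpU, hpc⟩, hqp⟩
  · exact (le_csSup hbdd (mem_image_of_mem T hqU)).trans (le_add_of_nonneg_right hB0)
  · have h1 := abs_sub_le_of_mem_sphCrit hv hT hrep hL hr hr1 hpc (hU' hq)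
    have h2 : ‖q - p‖ ^ 2 ≤ ρ ^ 2 := pow_le_pow_left₀ (norm_nonneg _) hqp 2
    have h3 : T q - T p ≤ Real.pi ^ 2 * L / (4 * r) * ρ ^ 2 :=
      ((le_abs_self _).trans h1).trans (mul_le_mul_of_nonneg_left h2 (by positivity))
    have h4 := apply_le_csSup_of_mem_closure hc hU hpU
    linarith

/-- **Event step, lower half**: under the same hypothesis, `sInf (T '' U) − π² L ρ² / (4 r) ≤ sInf (T '' U')`. [folklore] -/
theorem sInf_sub_le_sInf_of_near_sphCrit {v : E3 → E3} {T : E3 → ℝ} {x₀ : E3} {L r ρ : ℝ} (hv : ContDiff ℝ 2 v)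
    (hT : ContDiffOn ℝ 1 T ({x₀}ᶜ)) (hrep : ∀ x, curl v x = cross (gradient T x) (x - x₀))
    (hL : ∀ x ∈ Metric.closedBall x₀ 1, ‖fderiv ℝ (curl v) x‖ ≤ L) (hr : 0 < r) (hr1 : r ≤ 1)
    {U U' : Set E3} (hU : U ⊆ Metric.sphere x₀ r) (hU' : U' ⊆ Metric.sphere x₀ r) (hne' : U'.Nonempty)
    (hnear : ∀ q ∈ U', q ∈ U ∨ ∃ p ∈ closure U ∩ sphCrit T x₀ r, ‖q - p‖ ≤ ρ) :
    sInf (T '' U) - Real.pi ^ 2 * L / (4 * r) * ρ ^ 2 ≤ sInf (T '' U') := by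
  have hL0 : 0 ≤ L := (norm_nonneg _).trans (hL x₀ (Metric.mem_closedBall_self zero_le_one))
  have hc := continuousOn_sphere_of_continuousOn_compl hT.continuousOn hr
  have hbdd : BddBelow (T '' U) := ((isCompact_sphere x₀ r).bddBelow_image hc).mono (image_mono hU)
  refine le_csInf (hne'.image T) ?_
  rintro _ ⟨q, hq, rfl⟩
  have hB0 : 0 ≤ Real.pi ^ 2 * L / (4 * r) * ρ ^ 2 := by positivity
  rcases hnear q hq with hqU | ⟨p, ⟨hpU, hpc⟩, hqp⟩
  · linarith [csInf_le hbdd (mem_image_of_mem T hqU)]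
  · have h1 := abs_sub_le_of_mem_sphCrit hv hT hrep hL hr hr1 hpc (hU' hq)
    have h2 : ‖q - p‖ ^ 2 ≤ ρ ^ 2 := pow_le_pow_left₀ (norm_nonneg _) hqp 2
    have h12 : |T q - T p| ≤ Real.pi ^ 2 * L / (4 * r) * ρ ^ 2 := h1.trans (mul_le_mul_of_nonneg_left h2 (by positivity))
    have h3 : T p - T q ≤ Real.pi ^ 2 * L / (4 * r) * ρ ^ 2 := by
      have h := (abs_le.1 h12).1
      linarith
    have h4 := csInf_le_apply_of_mem_closure hc hU hpU
    linarith

/-- ★ **Event step**: if `U` and `U'` (nonempty subsets of `S_r(x₀)`, `0 < r ≤ 1`) differ only within `ρ` of sphere-critical points — every point of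
`U'` lies in `U` or within `ρ` of a sphere-critical point of `closure U`, and vice versa — then `|osc_{U'} T − osc_U T| ≤ π² L ρ² / (2 r)`.
[folklore] -/
theorem abs_setOsc_sub_setOsc_le_of_near_sphCrit {v : E3 → E3} {T : E3 → ℝ} {x₀ : E3} {L r ρ : ℝ} (hv : ContDiff ℝ 2 v)
    (hT : ContDiffOn ℝ 1 T ({x₀}ᶜ)) (hrep : ∀ x, curl v x = cross (gradient T x) (x - x₀))
    (hL : ∀ x ∈ Metric.closedBall x₀ 1, ‖fderiv ℝ (curl v) x‖ ≤ L) (hr : 0 < r) (hr1 : r ≤ 1)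
    {U U' : Set E3} (hU : U ⊆ Metric.sphere x₀ r) (hU' : U' ⊆ Metric.sphere x₀ r) (hne : U.Nonempty) (hne' : U'.Nonempty)
    (hnear : ∀ q ∈ U', q ∈ U ∨ ∃ p ∈ closure U ∩ sphCrit T x₀ r, ‖q - p‖ ≤ ρ)
    (hnear' : ∀ q ∈ U, q ∈ U' ∨ ∃ p ∈ closure U' ∩ sphCrit T x₀ r, ‖q - p‖ ≤ ρ) :
    |setOsc T U' - setOsc T U| ≤ Real.pi ^ 2 * L * ρ ^ 2 / (2 * r) := by
  have h1 := sSup_le_sSup_add_of_near_sphCrit hv hT hrep hL hr hr1 hU hU' hne' hnear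
  have h2 := sInf_sub_le_sInf_of_near_sphCrit hv hT hrep hL hr hr1 hU hU' hne' hnear
  have h3 := sSup_le_sSup_add_of_near_sphCrit hv hT hrep hL hr hr1 hU' hU hne hnear'
  have h4 := sInf_sub_le_sInf_of_near_sphCrit hv hT hrep hL hr hr1 hU' hU hne hnear'
  have e : Real.pi ^ 2 * L * ρ ^ 2 / (2 * r) = 2 * (Real.pi ^ 2 * L / (4 * r) * ρ ^ 2) := by field_simp; ring
  rw [e, abs_le, setOsc, setOsc]
  constructor <;> linarith

end Summit.NavierStokesRegularity.NavierStokesRegularity.Theorems.PoloidalLiouville.CellFlux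

end
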